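import Summits.MatrixMultiplication.MatrixMultiplication.Theorems.FarEdgeDescentWidthTransform

/-!
# Far-edge descent, kernel XL-D — the floor-constrained dial as a typed object (+ cap conjecture)

Critic g19 asked (ASKS g60 (i)) for the floor-dial cap «κ ≤ κ_S» as a TYPED target: schedules as
binary trees, a Lean definition.  This file supplies the objects (MODEL level):
* `Sched` — binary product schedules over width-`a` bases (`base b` = the anchored object
  `⟨1, b·L, 1⟩ ⊕ (L legs of width a)` normalised to leg mass `1`, anchor ratio `b ≥ 0`; `node s t` =
  the tensor product of the two sub-schedules; a DAG schedule with shared sub-objects has the same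
  VALUES as its tree unfolding, so trees lose nothing for statements about values);
* `Sched.qp β` — the dial's (anchor, width profile) of kernels XXXVIII/XXXIX-K/XL-A:
  `Q_P = QQ' + β(β−1)LL'`, `p_P = Q·p' + Q'·p + p·p'`, `L = p(1)`; `share = L/(Q+βL)`;
  `dev β y₀` — the first-order deviation (`y_P = (1−(β−1)λ')·y + (1−(β−1)λ)·y'`, base value
  `y₀ b`); `logSize` — additive, base value `log(b+β)`;
* `FloorOK a β` — the node floors of XXXIX-G at every depth `j ≥ 1`:
  `(2 − a^{-j})·T_j ≤ β·L`, `T_j` = leg mass at widths `≥ a^j`; `Admissible` — every sub-schedule's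
  object passes the floors (bases included: a base passes iff `β ≥ 2 − 1/a`, the Strassen floor, so
  below `2 − 1/a` NOTHING is admissible — the special endpoint of the lens dichotomy is empty);
* the FLOOR-DIAL CAP CONJECTURE, as Lean text over these definitions (deliberately NOT declared
  here: an unproved `def … : Prop` is a route item, to be filed `@[conjecture]` by the route's
  steward when wanted — this file only makes it typable):
  ```
  ∀ a β R : ℝ, 2 ≤ a → 1 < β → β < 2 → 0 ≤ R →
  ∀ y₀ : ℝ → ℝ, (∀ b : ℝ, 0 ≤ b → 0 ≤ y₀ b ∧ y₀ b ≤ R / (b + β)) →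
  ∃ C : ℝ, ∀ s : Sched, Sched.Admissible a β s →
    Sched.dev β y₀ s ≤ C * Sched.logSize β s ^ (Real.log (4 / 3) / Real.log 2)
  ```
  i.e. for base deviations `y₀ b ≤ R/(b+β)` ONE constant bounds `dev ≤ C·logSize^{log₂(4/3)}` over
  ALL admissible schedules — Schönhage's order `θ_S` is the cap for every `β ∈ (1,2)`.  Kernels
  XL-B/C prove the chain case (one child of every node a heavy base) outright at `β = 3/2, 19/10`
  and reduce any `β` to a finite check; memo NODE-g60 §2 reports the adversarial DAG numerics
  (greedy over caterpillars, earlier deep nodes, light bases: κ_eff = 0.343/0.380/0.402/0.412 at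
  β = 1.6/1.75/1.9/1.99, all below κ_S = 0.4150) and §3 the obstruction the chain potential meets
  on general trees.
Sanity lemmas: `qp_node`, `share_base`, `dev_node`, `logSize_pos`, `share_node` (the share of a
product is `λ + λ' − (2β−1)λλ'`, by `legmass_product` of XL-A) and `floorOK_base_iff` /
`admissible_base_iff` (a base passes the floors iff `β ≥ 2 − 1/a`: the Strassen floor).

HONEST FRAMING: definitions at MODEL level plus definitional sanity lemmas; the conjecture is TEXT,
not a declaration; nothing about tensors or `ω`; no `sorry`, no axioms.  References: kernels
XXXVIII, XXXIX-G/K, XL-A/B/C; Schönhage 1981 [Schonhage1981]; Landsberg–Ottaviani 2015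
[LandsbergOttaviani2015].
-/

noncomputable section

set_option linter.dupNamespace false

namespace Summit.MatrixMultiplication.MatrixMultiplication.Theorems.FarEdgeDescentFloorDial

open Polynomial Finset
open Summit.MatrixMultiplication.MatrixMultiplication.Theorems.FarEdgeDescentWidthTransform

/-- Binary product schedules over width-`a` bases with anchor ratio `b`. -/
inductive Sched : Type
  | base (b : ℝ) : Sched
  | node (s t : Sched) : Sched

namespace Sched

/-- The dial's (anchor, width profile) of a schedule at dial value `β`; a base has anchor `b` and
profile `X` (leg mass `1` at width `a¹`). -/
def qp (β : ℝ) : Sched → ℝ × Polynomial ℝ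
  | base b => (b, X)
  | node s t =>
      ((qp β s).1 * (qp β t).1 + β * (β - 1) * ((qp β s).2.eval 1) * ((qp β t).2.eval 1),
        C (qp β s).1 * (qp β t).2 + C (qp β t).1 * (qp β s).2 + (qp β s).2 * (qp β t).2)

/-- Anchor mass. -/
def anchor (β : ℝ) (s : Sched) : ℝ := (qp β s).1

/-- Width profile (coefficient of `X^e` = leg mass at width `a^e`). -/
def profile (β : ℝ) (s : Sched) : Polynomial ℝ := (qp β s).2

/-- Leg mass `L = p(1)`. -/
def legMass (β : ℝ) (s : Sched) : ℝ := (profile β s).eval 1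

/-- Share `λ = L/(Q + βL)`. -/
def share (β : ℝ) (s : Sched) : ℝ := legMass β s / (anchor β s + β * legMass β s)

/-- First-order deviation with base values `y₀`. -/
def dev (β : ℝ) (y₀ : ℝ → ℝ) : Sched → ℝ
  | base b => y₀ b
  | node s t => (1 - (β - 1) * share β t) * dev β y₀ s + (1 - (β - 1) * share β s) * dev β y₀ t

/-- Additive log-size, base value `log(b + β)`. -/
def logSize (β : ℝ) : Sched → ℝ
  | base b => Real.log (b + β)
  | node s t => logSize β s + logSize β t

/-- Leg mass at widths `≥ a^j`. -/
def tailMass (β : ℝ) (s : Sched) (j : ℕ) : ℝ :=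
  legMass β s - ∑ e ∈ range j, (profile β s).coeff e

/-- The node floors of kernel XXXIX-G at every depth: `(2 − a^{-j})·T_j ≤ β·L`. -/
def FloorOK (a β : ℝ) (s : Sched) : Prop :=
  ∀ j : ℕ, 1 ≤ j → (2 - a⁻¹ ^ j) * tailMass β s j ≤ β * legMass β s

/-- Every sub-schedule (bases included) has `b ≥ 0` and passes the floors. -/
def Admissible (a β : ℝ) : Sched → Prop
  | base b => 0 ≤ b ∧ FloorOK a β (base b)
  | node s t => Admissible a β s ∧ Admissible a β t ∧ FloorOK a β (node s t)

end Sched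

open Sched

/-! ## Sanity lemmas -/

/-- A base has anchor `b` and profile `X`. -/
theorem qp_base (β b : ℝ) : qp β (base b) = (b, X) := rfl

/-- The product rule of kernels XXXIX-K / XL-A, by definition. -/
theorem qp_node (β : ℝ) (s t : Sched) :
    anchor β (node s t) = anchor β s * anchor β t + β * (β - 1) * legMass β s * legMass β t ∧
    profile β (node s t) =
      C (anchor β s) * profile β t + C (anchor β t) * profile β s + profile β s * profile β t := by
  exact ⟨rfl, rfl⟩

/-- A base has leg mass `1`. -/
theorem legMass_base (β b : ℝ) : legMass β (base b) = 1 := by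
  simp [legMass, profile, qp]

/-- A base has share `1/(b + β)`. -/
theorem share_base (β b : ℝ) : share β (base b) = 1 / (b + β) := by
  simp [share, anchor, legMass_base, qp]

/-- The deviation of a product (damping by the partner's share). -/
theorem dev_node (β : ℝ) (y₀ : ℝ → ℝ) (s t : Sched) :
    dev β y₀ (node s t) =
      (1 - (β - 1) * share β t) * dev β y₀ s + (1 - (β - 1) * share β s) * dev β y₀ t := rfl

/-- Leg mass of a product: `L_P = Q·L' + Q'·L + L·L'`. -/
theorem legMass_node (β : ℝ) (s t : Sched) :
    legMass β (node s t) =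
      anchor β s * legMass β t + anchor β t * legMass β s + legMass β s * legMass β t := by
  show (profile β (node s t)).eval 1 = _
  rw [(qp_node β s t).2, legmass_product]
  rfl

/-- **Share of a product** (the chain clause of XL-B): if both factors have `Q + βL ≠ 0`, then
`λ_P = λ + λ' − (2β−1)·λ·λ'`. -/
theorem share_node {β : ℝ} {s t : Sched} (hs : anchor β s + β * legMass β s ≠ 0)
    (ht : anchor β t + β * legMass β t ≠ 0) :
    share β (node s t) = share β s + share β t - (2 * β - 1) * share β s * share β t := by
  have hP : anchor β (node s t) + β * legMass β (node s t) =
      (anchor β s + β * legMass β s) * (anchor β t + β * legMass β t) := by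
    rw [legMass_node, (qp_node β s t).1]; ring
  unfold share
  rw [hP, legMass_node]
  set r := anchor β s + β * legMass β s with hr
  set r' := anchor β t + β * legMass β t with hr'
  rw [div_add_div _ _ hs ht, mul_assoc, div_mul_div_comm, ← mul_div_assoc, div_sub_div_same,
    div_eq_div_iff (mul_ne_zero hs ht) (mul_ne_zero hs ht), hr, hr']
  ring

/-- A base has all its leg mass at depth `1`. -/
theorem tailMass_base_one (β b : ℝ) : tailMass β (base b) 1 = 1 := by
  simp [tailMass, legMass_base, profile, qp]

/-- A base has no leg mass at depth `≥ 2`. -/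
theorem tailMass_base_of_two_le (β b : ℝ) {j : ℕ} (hj : 2 ≤ j) : tailMass β (base b) j = 0 := by
  have hj' : 1 < j := hj
  simp [tailMass, legMass_base, profile, qp, Polynomial.coeff_X, Finset.mem_range, hj']

/-- **A base passes the floors iff `β ≥ 2 − 1/a`** — the Strassen floor of kernel XXXIX-A: below it
no schedule is admissible (the special endpoint of the dichotomy is empty). -/
theorem floorOK_base_iff {a β : ℝ} (hβ : 0 ≤ β) (b : ℝ) : FloorOK a β (base b) ↔ 2 - a⁻¹ ≤ β := by
  constructor
  · intro h
    have h1 := h 1 le_rfl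
    rw [tailMass_base_one, legMass_base, pow_one] at h1
    linarith
  · intro h j hj
    rcases eq_or_lt_of_le hj with h1 | hj2
    · rw [← h1, tailMass_base_one, legMass_base, pow_one]; linarith
    · rw [tailMass_base_of_two_le β b hj2, legMass_base, mul_zero, mul_one]; exact hβ

/-- Hence a base is admissible iff `b ≥ 0` and `β ≥ 2 − 1/a`. -/
theorem admissible_base_iff {a β : ℝ} (hβ : 0 ≤ β) (b : ℝ) :
    Admissible a β (base b) ↔ 0 ≤ b ∧ 2 - a⁻¹ ≤ β := by
  show 0 ≤ b ∧ FloorOK a β (base b) ↔ _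
  rw [floorOK_base_iff hβ]

/-- Log-size is positive on admissible schedules with `β > 1` (each base contributes
`log(b+β) > 0`). -/
theorem logSize_pos {a β : ℝ} (hβ : 1 < β) : ∀ s : Sched, Admissible a β s → 0 < logSize β s
  | base b, h => by
      have hb : 0 ≤ b := h.1
      exact Real.log_pos (by linarith)
  | node s t, h => by
      have := logSize_pos hβ s h.1
      have := logSize_pos hβ t h.2.1
      show 0 < logSize β s + logSize β t
      linarith

end Summit.MatrixMultiplication.MatrixMultiplication.Theorems.FarEdgeDescentFloorDial
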